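import Summits.HodgeConjecture.CorCM.IrreducibleOddWeightsCoreTowerCMFields
import Summits.HodgeConjecture.CorCM.IrreducibleOddWeightsCanonicalPivotTraceExact
import HarnessLib

/-!
# Core tower, III: EXACTNESS — when the Galois closure of the trace `K₁ ∩ L₀` lies inside `K₁`, additivity for ALL CM
# types holds **iff** `a(K₀) ∩ b(K₁) ⊂ ℝ`; the level-two bound; the Hodge side

COR-CM (cell `pub-hodgecm2`, binder seat `b16` gen 67, count-neutral claim CORE TOWER, file A3; theorems only, no
definition, no named fact, no `sorry`).  NEW as stated, hence under `Summits/`.  HONEST FRAMING: exact type-free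
criteria for `Hg(A₀ × A₁) = Hg(A₀) × Hg(A₁)` and unconditional statements on which Hodge classes on `A₀^a × A₁^b` are sums
of products (abelian varieties with complex multiplication); no Hodge class is claimed algebraic beyond the tree's
nondegenerate case; `HC_CM` is neither used nor asserted.

SETTING (A2 `IrreducibleOddWeightsCoreTowerCMFields`).  CM fields `K_{i₀}, K_{i₁}`, `L_κ` their Galois closures in `ℂ`,
`b₀ : K_{i₁} → ℂ`; the TRACE FIELD `T₁ = b₀⁻¹(L₀) ≤ K_{i₁}` of `L₀` on `K_{i₁}` and its Galois closure
`E₁ = normalClosure ℚ T₁ ℂ ⊆ L₀ ∩ L₁`.  A2 proved: `a(K_{i₀}) ∩ E₁ ⊂ ℝ` for every `a` ⟹ `Hg(A₀ × A₁) = Hg(A₀) × Hg(A₁)`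
for all CM types.

* §1 **EXACTNESS** (`forall_cmFamilyRank_add_card_eq_iff_of_traceClosure_le_fieldRange`): if `E₁ ⊆ b₀(K_{i₁})` — the
  Galois closure of the trace lies INSIDE `K_{i₁}` — then additivity for ALL types **iff** `a(K_{i₀}) ∩ E₁ ⊂ ℝ` for every
  `a` (`⟹`: a moved element of `a(K_{i₀}) ∩ E₁` makes the trace of `E₁` on `K_{i₀}` a CM field embedded in BOTH fields,
  and the pair induced from one of its CM types interacts — gen 66 T2; `exists_cmFamilyRank_add_card_lt_of_mem_of_le_fieldRange`).
  **NORMAL TRACE** (`forall_cmFamilyRank_add_card_eq_iff_of_normal_trace`): if the trace field `T₁` is normal over `ℚ`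
  then additivity for all types **iff complex conjugation fixes `a(K_{i₀}) ∩ b₀(K_{i₁})` pointwise for every `a`** (iff
  the two fields have no common CM subfield in any position).  This contains gen 66 T4 (`K_{i₁}` Galois:
  `traceClosure_le_fieldRange_of_normal`) and gen 62 O8 (closures meeting in a quadratic field), and is new e.g. for an
  imaginary-quadratic or Galois-CM trace `K₁ ∩ L₀` with `L₀ ∩ L₁` larger: THEN `Hg(A₀ × A₁) = Hg(A₀) × Hg(A₁)` for all
  types iff that Galois CM field meets every conjugate of `K₀` in a real field (for an imaginary quadratic trace
  `k`: iff `k ⊄ a(K₀)`).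
* §2 The LEVEL-TWO BOUND (`two_mul_cmTypeRank_add_le_card_traceClasses_of_traces_le`):
  `2·(dim Hg(A₀) + dim Hg(A₁) − dim Hg(A₀ × A₁)) ≤ #{complex classes of Hom(K_{i₀}, ℂ) for L_{T₁}}` (at most the number of
  complex places of `K_{i₀} ∩ E₁`; gen 65/66 had the classes for `L₁`).
* §3 HODGE SIDE of the level-two criterion: no mixed Hodge classes on any `A₀^a × A₁^b`, HC on all products for
  nondegenerate types (tree's Pohlmann–Gordon theorem); and under exactness a moved element yields a MIXED exceptional
  class for some types.

## References

* [Gordon1999HodgeAVSurvey] B. B. Gordon, *A survey of the Hodge conjecture for abelian varieties*, §3 Theorem (proof),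
  7.5–7.7, 7.6.1, 10.10.
* [MoonenZarhin1999LowDim] B. Moonen, Yu. Zarhin, Math. Ann. 315 (1999), Thm. (0.2), §3 (3.1).
* [Lang2002] S. Lang, *Algebra*, 3rd ed., VI §1 Thm. 1.1, Cor. 1.6, Thm. 1.12 and V §2 Thm. 2.8.
* [Shimura1998] G. Shimura, *Abelian Varieties with Complex Multiplication and Modular Functions*, §18.1, §18.2, §32.9.
-/

set_option autoImplicit false

noncomputable section

open scoped BigOperators Classical
open CategoryTheory CategoryTheory.Limits NumberField Module IntermediateField

namespace Summit.HodgeConjecture.CorCM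

open Literature.NumberTheory.ComplexMultiplication Literature.AlgebraicGeometry.Pohlmann1968
open Literature.AlgebraicGeometry.Motives (AbelianVariety CMType)
open Literature.AlgebraicGeometry.Motives.AbelianVariety
open Literature.AlgebraicGeometry.HodgeTheory
open Literature.AlgebraicGeometry.ComplexMultiplication (IsCMTypeRealisation)

/-! ### §1 Exactness when the Galois closure of the trace lies inside `K_{i₁}` -/

section Exact

variable {I : Type} [Fintype I] {K : I → Type} [∀ i, Field (K i)] [∀ i, NumberField (K i)] [∀ i, IsCMField (K i)]

/-- **A MOVED ELEMENT OF `a₀(K_{i₀}) ∩ E` YIELDS AN INTERACTING PAIR WHENEVER `E ⊆ b₀(K_{i₁})`.**  `E` any subfield of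
`ℂ` contained in the image of `b₀`, `a₀ k₀ ∈ E` with `ρ k₀ ≠ k₀`: there are CM types `Φ` with
`cmFamilyRank Φ + 2 < cmTypeRank Φ₀ + cmTypeRank Φ₁ + 1` (`Hg(A₀ × A₁) ⊊ Hg(A₀) × Hg(A₁)`) — the pair induced from a CM type
of the trace `a₀⁻¹(E) ≤ K_{i₀}`, a CM field embedded in both (gen 66 T4 assumed `K_{i₁}` normal and `E = L₁`).
[cite: Gordon1999HodgeAVSurvey, 7.5–7.7 and 7.6.1] [cite: Shimura1998, §32.9] [cite: Lang2002, V §2 Thm. 2.8] -/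
theorem exists_cmFamilyRank_add_card_lt_of_mem_of_le_fieldRange {i₀ i₁ : I} (h01 : i₀ ≠ i₁)
    (hI : ∀ l, l = i₀ ∨ l = i₁) (a₀ : K i₀ →+* ℂ) (b₀ : K i₁ →+* ℂ) (E : IntermediateField ℚ ℂ)
    (hE : E ≤ b₀.toRatAlgHom.fieldRange) {k₀ : K i₀} (hk₀ : a₀ k₀ ∈ E) (hreal : k₀ ∉ maximalRealSubfield (K i₀)) :
    ∃ Φ : ∀ i, CMType (K i), CMAlgebra.cmFamilyRank Φ + Fintype.card I < (∑ i, cmTypeRank (Φ i)) + 1 := by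
  set T : IntermediateField ℚ (K i₀) := E.comap a₀.toRatAlgHom with hT
  have hk₀T : k₀ ∈ T := hk₀
  -- a CM type of the trace field
  obtain ⟨φ⟩ := nonempty_cmType_of_forall_conjugate_ne (conjugate_ne_of_not_mem_maximalRealSubfield T hk₀T hreal)
  -- embeddings of `T` into both fields: the inclusion, and `b₀⁻¹ ∘ a₀` (as `a₀(T) ⊆ E ⊆ b₀(K_{i₁})`)
  let f : ↥T →ₐ[ℚ] ℂ := a₀.toRatAlgHom.comp T.val
  have hf : ∀ k, f k ∈ b₀.toRatAlgHom.range := fun k => by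
    have hk : a₀.toRatAlgHom (k : K i₀) ∈ E := k.2
    exact hE hk
  let e₁ : ↥T →+* K i₁ :=
    ((AlgEquiv.ofInjectiveField b₀.toRatAlgHom).symm.toAlgHom.comp (f.codRestrict b₀.toRatAlgHom.range hf)).toRingHom
  let e₀ : ↥T →+* K i₀ := algebraMap ↥T (K i₀)
  let e : ∀ i, ↥T →+* K i := fun i =>
    if h : i = i₀ then h ▸ e₀ else ((hI i).resolve_left h) ▸ e₁
  refine ⟨fun i => inducedCMType (e i) φ, ?_⟩
  haveI : Nonempty I := ⟨i₀⟩
  have hcard : Fintype.card I = 2 := by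
    rw [← Finset.card_univ, show (Finset.univ : Finset I) = {i₀, i₁} from Finset.ext fun j => by
      simpa only [Finset.mem_univ, Finset.mem_insert, Finset.mem_singleton, true_iff] using hI j,
      Finset.card_pair h01]
  have hpair := cmTypeRank_add_cmTypeRank_inducedCMType_pair i₀ i₁ e φ
  have h2 := two_le_cmTypeRank_of_cmType φ
  rw [IrrOdd.sum_eq_add_of_pair _ hI h01, hcard, hpair]
  omega

/-- **EXACTNESS WHEN THE GALOIS CLOSURE OF THE TRACE LIES INSIDE `K_{i₁}`.**  Let `T₁ = b₀⁻¹(L₀) ≤ K_{i₁}` be the trace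
field and `E₁ = normalClosure ℚ T₁ ℂ` its Galois closure; assume `E₁ ⊆ b₀(K_{i₁})`.  Then `cmFamilyRank Φ + 2 =
cmTypeRank Φ₀ + cmTypeRank Φ₁ + 1` for EVERY family of CM types (**`Hg(A₀ × A₁) = Hg(A₀) × Hg(A₁)` for all realisations**)
**iff complex conjugation fixes `a(K_{i₀}) ∩ E₁` pointwise for every embedding `a`.**  (`⟸` A2; `⟹` above.)
[cite: Gordon1999HodgeAVSurvey, §3 Theorem (proof), 7.5–7.7 and 7.6.1] [cite: MoonenZarhin1999LowDim, Thm. (0.2)]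
[cite: Shimura1998, §18.2 and §32.9] -/
theorem forall_cmFamilyRank_add_card_eq_iff_of_traceClosure_le_fieldRange {i₀ i₁ : I} (h01 : i₀ ≠ i₁)
    (hI : ∀ l, l = i₀ ∨ l = i₁) (b₀ : K i₁ →+* ℂ)
    (hgal : normalClosure ℚ ↥((normalClosure ℚ (K i₀) ℂ).comap b₀.toRatAlgHom) ℂ ≤ b₀.toRatAlgHom.fieldRange) :
    (∀ Φ : ∀ i, CMType (K i), CMAlgebra.cmFamilyRank Φ + Fintype.card I = (∑ i, cmTypeRank (Φ i)) + 1) ↔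
      ∀ (a : K i₀ →+* ℂ) (k : K i₀),
        a k ∈ normalClosure ℚ ↥((normalClosure ℚ (K i₀) ℂ).comap b₀.toRatAlgHom) ℂ → starRingEnd ℂ (a k) = a k := by
  constructor
  · intro hall a k hk
    by_contra hne
    have hreal : k ∉ maximalRealSubfield (K i₀) := fun hmem =>
      hne ((conj_apply_eq_iff_mem_maximalRealSubfield a k).2 hmem)
    obtain ⟨Φ, hlt⟩ := exists_cmFamilyRank_add_card_lt_of_mem_of_le_fieldRange h01 hI a b₀ _ hgal hk hreal
    exact absurd (hall Φ) hlt.ne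
  · intro hreal Φ
    exact cmFamilyRank_add_card_eq_pair_of_forall_conj_apply_eq_traceClosure h01 hI Φ b₀ hreal

omit [Fintype I] [∀ i, IsCMField (K i)] in
/-- The elements of `a(K_{i₀}) ∩ b₀(K_{i₁})` lie in the Galois closure `E₁` of the trace field `b₀⁻¹(L₀)` (indeed in the
image of the trace field: `a(K_{i₀}) ⊆ L₀`). [cite: Lang2002, VI §1 Thm. 1.12] -/
theorem apply_mem_traceClosure_of_mem_fieldRange {i₀ i₁ : I} (b₀ : K i₁ →+* ℂ) (a : K i₀ →+* ℂ) (k : K i₀)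
    (hk : a k ∈ b₀.toRatAlgHom.fieldRange) :
    a k ∈ normalClosure ℚ ↥((normalClosure ℚ (K i₀) ℂ).comap b₀.toRatAlgHom) ℂ := by
  obtain ⟨k', hk'⟩ := AlgHom.mem_fieldRange.1 hk
  have hk'T : k' ∈ (normalClosure ℚ (K i₀) ℂ).comap b₀.toRatAlgHom := by
    change b₀.toRatAlgHom k' ∈ normalClosure ℚ (K i₀) ℂ
    rw [hk']
    exact apply_mem_normalClosure i₀ a k
  have e : a k = (b₀.comp (algebraMap ↥((normalClosure ℚ (K i₀) ℂ).comap b₀.toRatAlgHom) (K i₁))) ⟨k', hk'T⟩ := by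
    rw [RingHom.comp_apply, IntermediateField.algebraMap_apply]
    exact hk'.symm
  rw [e]
  exact apply_mem_normalClosure (K := fun _ : Unit => ↥((normalClosure ℚ (K i₀) ℂ).comap b₀.toRatAlgHom)) () _ _

omit [Fintype I] [∀ i, IsCMField (K i)] in
/-- **A NORMAL TRACE FIELD has its Galois closure inside `K_{i₁}`**: if `T₁ = b₀⁻¹(L₀)` is normal over `ℚ` then
`E₁ = b₀(T₁) ⊆ b₀(K_{i₁})`, and `z ∈ E₁ ↔ z ∈ a`-independent image `b₀(K_{i₁}) ∩ L₀`. [cite: Lang2002, VI §1 Thm. 1.1] -/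
theorem traceClosure_le_fieldRange_of_normal_trace {i₀ i₁ : I} (b₀ : K i₁ →+* ℂ)
    (hn : Normal ℚ ↥((normalClosure ℚ (K i₀) ℂ).comap b₀.toRatAlgHom)) :
    normalClosure ℚ ↥((normalClosure ℚ (K i₀) ℂ).comap b₀.toRatAlgHom) ℂ ≤ b₀.toRatAlgHom.fieldRange := by
  rw [normalClosure_eq_fieldRange_of_normal
    (b₀.toRatAlgHom.comp ((normalClosure ℚ (K i₀) ℂ).comap b₀.toRatAlgHom).val)]
  rintro _ ⟨k, rfl⟩
  exact ⟨(k : K i₁), rfl⟩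

omit [Fintype I] [∀ i, IsCMField (K i)] in
/-- **A GALOIS PARTNER has the Galois closure of the trace inside itself**: `K_{i₁}` normal ⟹ every embedding of the
trace field extends to `K_{i₁}` and lands in `L₁ = b₀(K_{i₁})` (so §1 contains gen 66 T4).
[cite: Lang2002, V §2 Thm. 2.8 and VI §1 Thm. 1.1] -/
theorem traceClosure_le_fieldRange_of_normal {i₀ i₁ : I} (b₀ : K i₁ →+* ℂ) (hK₁ : Normal ℚ (K i₁)) :
    normalClosure ℚ ↥((normalClosure ℚ (K i₀) ℂ).comap b₀.toRatAlgHom) ℂ ≤ b₀.toRatAlgHom.fieldRange := by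
  rw [← normalClosure_eq_fieldRange_of_normal b₀.toRatAlgHom]
  refine normalClosure_le_iff.2 fun f => ?_
  obtain ⟨t, ht⟩ := exists_comp_algebraMap_eq ((normalClosure ℚ (K i₀) ℂ).comap b₀.toRatAlgHom) f.toRingHom
  rintro _ ⟨k, rfl⟩
  have e : f k = t (k : K i₁) := by
    rw [← IntermediateField.algebraMap_apply, ← RingHom.comp_apply, ht]
    rfl
  change f k ∈ normalClosure ℚ (K i₁) ℂ
  rw [e]
  exact apply_mem_normalClosure i₁ t k

/-- **THE EXACT CRITERION FOR A NORMAL TRACE.**  If the trace field `T₁ = b₀⁻¹(L₀) ≤ K_{i₁}` of `L₀` on `K_{i₁}` is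
normal over `ℚ` (e.g. `K_{i₁}` Galois — T4; the Galois closures meeting in a quadratic field — O8; or an imaginary
quadratic / Galois CM trace with `L₀ ∩ L₁` larger — new), then `cmFamilyRank Φ + 2 = cmTypeRank Φ₀ + cmTypeRank Φ₁ + 1`
for EVERY family of CM types (**`Hg(A₀ × A₁) = Hg(A₀) × Hg(A₁)` for all realisations**) **iff complex conjugation fixes
`a(K_{i₀}) ∩ b₀(K_{i₁})` pointwise for every embedding `a`** — iff no conjugate of `K_{i₀}` meets `b₀(K_{i₁})` in a CM
field. [cite: Gordon1999HodgeAVSurvey, §3 Theorem (proof), 7.5–7.7 and 7.6.1] [cite: MoonenZarhin1999LowDim, Thm. (0.2)]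
[cite: Lang2002, VI §1 Thm. 1.1 and Cor. 1.6] -/
theorem forall_cmFamilyRank_add_card_eq_iff_of_normal_trace {i₀ i₁ : I} (h01 : i₀ ≠ i₁)
    (hI : ∀ l, l = i₀ ∨ l = i₁) (b₀ : K i₁ →+* ℂ)
    (hn : Normal ℚ ↥((normalClosure ℚ (K i₀) ℂ).comap b₀.toRatAlgHom)) :
    (∀ Φ : ∀ i, CMType (K i), CMAlgebra.cmFamilyRank Φ + Fintype.card I = (∑ i, cmTypeRank (Φ i)) + 1) ↔
      ∀ (a : K i₀ →+* ℂ) (k : K i₀), a k ∈ b₀.toRatAlgHom.fieldRange → starRingEnd ℂ (a k) = a k := by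
  rw [forall_cmFamilyRank_add_card_eq_iff_of_traceClosure_le_fieldRange h01 hI b₀
    (traceClosure_le_fieldRange_of_normal_trace b₀ hn)]
  constructor
  · intro h a k hk
    exact h a k (apply_mem_traceClosure_of_mem_fieldRange b₀ a k hk)
  · intro h a k hk
    exact h a k (traceClosure_le_fieldRange_of_normal_trace b₀ hn hk)

/-- **… equivalently, tested on the two subfields of `ℂ`**: for a normal trace field, additivity for all types iff
conjugation fixes `a(K_{i₀}) ∩ b₀(K_{i₁}) ⊆ ℂ` pointwise for every `a`. [cite: Gordon1999HodgeAVSurvey, §3 Theorem (proof)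
and 7.5–7.7] [cite: Lang2002, VI §1 Thm. 1.1 and Cor. 1.6] -/
theorem forall_cmFamilyRank_add_card_eq_iff_forall_fieldRange_inf_of_normal_trace {i₀ i₁ : I} (h01 : i₀ ≠ i₁)
    (hI : ∀ l, l = i₀ ∨ l = i₁) (b₀ : K i₁ →+* ℂ)
    (hn : Normal ℚ ↥((normalClosure ℚ (K i₀) ℂ).comap b₀.toRatAlgHom)) :
    (∀ Φ : ∀ i, CMType (K i), CMAlgebra.cmFamilyRank Φ + Fintype.card I = (∑ i, cmTypeRank (Φ i)) + 1) ↔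
      ∀ (a : K i₀ →+* ℂ) (z : ℂ), z ∈ a.toRatAlgHom.fieldRange → z ∈ b₀.toRatAlgHom.fieldRange →
        starRingEnd ℂ z = z := by
  rw [forall_cmFamilyRank_add_card_eq_iff_of_normal_trace h01 hI b₀ hn]
  constructor
  · intro h a z hz₀ hz₁
    obtain ⟨k, rfl⟩ := AlgHom.mem_fieldRange.1 hz₀
    exact h a k hz₁
  · intro h a k hk
    exact h a _ (AlgHom.mem_fieldRange.2 ⟨k, rfl⟩) hk

end Exact

/-! ### §2 The level-two bound -/

section Bound

variable {I : Type} [Fintype I] {K : I → Type} [∀ i, Field (K i)] [∀ i, NumberField (K i)] [∀ i, IsCMField (K i)]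
  {T : Type} [Field T] [NumberField T]

/-- **THE LEVEL-TWO BOUND: `2·(dim Hg(A₀) + dim Hg(A₁) − dim Hg(A₀ × A₁)) ≤ #{COMPLEX T₁-CLASSES on Hom(K_{i₀}, ℂ)}`** — the
classes of embeddings of `K_{i₀}` agreeing on the trace of `L_{T₁}` (`T₁` any number field with `b(K_{i₁}) ∩ L₀ ⊆ L_{T₁}`
for all `b`, canonically the trace field) that differ from their complex-conjugate class: at most the number of complex
places of `K_{i₀} ∩ E₁`, fewer than gen 65/66's classes for `L₁`.
[cite: Gordon1999HodgeAVSurvey, §3 Theorem (proof) and 7.5–7.7] [cite: Shimura1998, §18.1] -/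
theorem two_mul_cmTypeRank_add_le_card_traceClasses_of_traces_le {i₀ i₁ : I} (h01 : i₀ ≠ i₁)
    (hI : ∀ l, l = i₀ ∨ l = i₁) (Φ : ∀ i, CMType (K i))
    (hT₁ : ∀ (b : K i₁ →+* ℂ) (k : K i₁), b k ∈ normalClosure ℚ (K i₀) ℂ → b k ∈ normalClosure ℚ T ℂ) :
    2 * (cmTypeRank (Φ i₀) + cmTypeRank (Φ i₁)) ≤ 2 * (CMAlgebra.cmFamilyRank Φ + 1) +
      ((Finset.univ.image fun a : K i₀ →+* ℂ => Finset.univ.filter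
          (fun t : K i₀ →+* ℂ => ∀ k : K i₀, a k ∈ normalClosure ℚ T ℂ → t k = a k)).filter
        fun C => C.image (fun t => (starRingAut : ℂ ≃+* ℂ) • t) ≠ C).card := by
  haveI : ∀ i, Nonempty (K i →+* ℂ) := fun i => inferInstance
  have hexact := IrrOdd.typeRank_add_typeRank_eq_add_finrank_of_absorbed (G := ℂ ≃+* ℂ) (E := fun i => K i →+* ℂ)
    (Φ := fun i => (Φ i).1) (fun i => isCMTypeWith_conj (Φ i)) hI h01 (W := T →+* ℂ)
    (span_coeff_inf_eq_of_traces_le Φ i₀ i₁ hT₁)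
  have hbound := IrrOdd.two_mul_finrank_span_stabOrbitSum_le_card (G := ℂ ≃+* ℂ) (W := T →+* ℂ)
    (isCMTypeWith_conj (Φ i₀))
  haveI := IrrOdd.finite_span_coeff (G := ℂ ≃+* ℂ) (Φ i₀).1
  have hle₀ := IrrOdd.span_stabOrbitSum_le_span_coeff (G := ℂ ≃+* ℂ) (W := T →+* ℂ) (Φ i₀).1
  haveI := Module.Finite.of_injective (Submodule.inclusion hle₀) (Submodule.inclusion_injective hle₀)
  have hinf := Submodule.finrank_mono (inf_le_left :
    Submodule.span ℚ (Set.range fun a : K i₀ →+* ℂ => fun g : ℂ ≃+* ℂ =>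
        ∑ t ∈ Finset.univ.filter
          (fun t : K i₀ →+* ℂ => ∃ n : ℂ ≃+* ℂ, (∀ y : T →+* ℂ, n • y = y) ∧ n • a = t), antiVec (Φ i₀).1 g t) ⊓
      Submodule.span ℚ (Set.range fun a : K i₁ →+* ℂ => fun g : ℂ ≃+* ℂ =>
        ∑ t ∈ Finset.univ.filter
          (fun t : K i₁ →+* ℂ => ∃ n : ℂ ≃+* ℂ, (∀ y : T →+* ℂ, n • y = y) ∧ n • a = t), antiVec (Φ i₁).1 g t) ≤ _)
  have hfilter : ∀ a : K i₀ →+* ℂ, Finset.univ.filter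
      (fun t : K i₀ →+* ℂ => ∃ n : ℂ ≃+* ℂ, (∀ y : T →+* ℂ, n • y = y) ∧ n • a = t) =
        Finset.univ.filter (fun t : K i₀ →+* ℂ => ∀ k : K i₀, a k ∈ normalClosure ℚ T ℂ → t k = a k) :=
    fun a => Finset.filter_congr fun t _ => exists_stabAux_smul_eq_iff_forall_apply_eq (T := T) a t
  simp only [hfilter] at hbound
  change 2 * (typeRank (ℂ ≃+* ℂ) (Φ i₀).1 + typeRank (ℂ ≃+* ℂ) (Φ i₁).1) ≤
    2 * (typeRank (ℂ ≃+* ℂ) (sigmaType fun i => (Φ i).1) + 1) + _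
  omega

end Bound

/-! ### §3 Hodge side -/

section Hodge

variable {I : Type} [Fintype I] [DecidableEq I] {K : I → Type} [∀ i, Field (K i)] [∀ i, NumberField (K i)]
  [∀ i, IsCMField (K i)] {Φ : ∀ i, CMType (K i)} {A : I → AbelianVariety ℂ} {ιA : ∀ i, 𝓞 (K i) →+* End (A i)}
  {θ : ∀ i, K i →+* Module.End ℂ (complexBetti (A i).X 1)}

/-- **NO MIXED HODGE CLASSES under the level-two criterion**: if conjugation fixes `a(K_{i₀}) ∩ E₁` pointwise for every `a`
(`E₁` the Galois closure of the trace field `b₀⁻¹(L₀)`), then every rational Hodge class on every `A₀^a × A₁^b` (disjoint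
slot maps) is a `ℂ`-combination of exterior products of Hodge classes of the factors, whatever the types.
[cite: MoonenZarhin1999LowDim, §3 (3.1)] [cite: Gordon1999HodgeAVSurvey, 7.5–7.7] -/
theorem forall_hodgeClassesProductSpan_pair_of_forall_conj_apply_eq_traceClosure {i₀ i₁ : I} (h01 : i₀ ≠ i₁)
    (hI : ∀ l, l = i₀ ∨ l = i₁) (b₀ : K i₁ →+* ℂ)
    (hreal : ∀ (a : K i₀ →+* ℂ) (k : K i₀),
      a k ∈ normalClosure ℚ ↥((normalClosure ℚ (K i₀) ℂ).comap b₀.toRatAlgHom) ℂ → starRingEnd ℂ (a k) = a k)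
    (hA : ∀ i, IsCMTypeRealisation (Φ i) (A i) (ιA i) (θ i)) (N₁ N₂ : ℕ) [NeZero N₁] [NeZero N₂] (π₁ : Fin N₁ → I)
    (π₂ : Fin N₂ → I) (hdisj : ∀ l₁ l₂, π₁ l₁ ≠ π₂ l₂) :
    HodgeClassesProductSpan (⨁ fun l => A (π₁ l)) (⨁ fun l => A (π₂ l)) := by
  haveI : Nonempty I := ⟨i₀⟩
  exact (cmFamilyRank_add_card_eq_iff_forall_hodgeClassesProductSpan hA).1
    (cmFamilyRank_add_card_eq_pair_of_forall_conj_apply_eq_traceClosure h01 hI Φ b₀ hreal) N₁ N₂ π₁ π₂ hdisj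

omit [DecidableEq I] in
/-- **… and for NONDEGENERATE `Φ₀`, `Φ₁` every product `⨁_l A_{π l}` satisfies the Hodge conjecture, unconditionally**
(the family is nondegenerate — A2 — and nondegenerate families are covered by the tree's Pohlmann–Gordon theorem).
[cite: Gordon1999HodgeAVSurvey, 10.10 and 7.5] [cite: MoonenZarhin1999LowDim, Thm. (0.2)] -/
theorem hodgeConjectureFor_prod_of_forall_conj_apply_eq_traceClosure {i₀ i₁ : I} (h01 : i₀ ≠ i₁)
    (hI : ∀ l, l = i₀ ∨ l = i₁) (b₀ : K i₁ →+* ℂ)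
    (hreal : ∀ (a : K i₀ →+* ℂ) (k : K i₀),
      a k ∈ normalClosure ℚ ↥((normalClosure ℚ (K i₀) ℂ).comap b₀.toRatAlgHom) ℂ → starRingEnd ℂ (a k) = a k)
    (hnd : ∀ i, IsNondegenerate (Φ i)) (hA : ∀ i, IsCMTypeRealisation (Φ i) (A i) (ιA i) (θ i)) {N : ℕ}
    (π : Fin N → I) :
    HodgeConjectureFor (⨁ fun l : Fin N => A (π l)).dim (⨁ fun l : Fin N => A (π l)).X := by
  haveI : Nonempty I := ⟨i₀⟩
  exact ((isNondegenerateFamily_iff_forall_of_traces_le_of_forall_conj_apply_eq h01 hI Φ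
    (T := ↥((normalClosure ℚ (K i₀) ℂ).comap b₀.toRatAlgHom))
    (fun b k hk => apply_mem_normalClosure_comap_of_mem (T := K i₀) b₀ b k hk) hreal).2 hnd).hodgeConjectureFor_prod
    hA π

/-- **EXACTNESS, HODGE SIDE**: if `E₁ ⊆ b₀(K_{i₁})` (e.g. a normal trace field) and some `a₀ k₀ ∈ E₁` is moved by
conjugation, then there are CM types `Φ` such that EVERY family of realisations carries, on some `A_{π₁}^• × A_{π₂}^•`
with disjoint slot maps, a rational Hodge class that is NOT a combination of exterior products.
[cite: MoonenZarhin1999LowDim, §3 (3.1)] [cite: Gordon1999HodgeAVSurvey, 7.5–7.7 and 7.6.1] -/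
theorem exists_cmType_not_hodgeClassesProductSpan_of_mem_traceClosure {i₀ i₁ : I} (h01 : i₀ ≠ i₁)
    (hI : ∀ l, l = i₀ ∨ l = i₁) (a₀ : K i₀ →+* ℂ) (b₀ : K i₁ →+* ℂ)
    (hgal : normalClosure ℚ ↥((normalClosure ℚ (K i₀) ℂ).comap b₀.toRatAlgHom) ℂ ≤ b₀.toRatAlgHom.fieldRange)
    {k₀ : K i₀} (hk₀ : a₀ k₀ ∈ normalClosure ℚ ↥((normalClosure ℚ (K i₀) ℂ).comap b₀.toRatAlgHom) ℂ)
    (hreal : k₀ ∉ maximalRealSubfield (K i₀)) :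
    ∃ Φ : ∀ i, CMType (K i), ∀ (A : I → AbelianVariety ℂ) (ιA : ∀ i, 𝓞 (K i) →+* End (A i))
      (θ : ∀ i, K i →+* Module.End ℂ (complexBetti (A i).X 1)),
      (∀ i, IsCMTypeRealisation (Φ i) (A i) (ιA i) (θ i)) →
        ∃ (N₁ N₂ : ℕ) (_ : NeZero N₁) (_ : NeZero N₂) (π₁ : Fin N₁ → I) (π₂ : Fin N₂ → I),
          (∀ j₁ j₂, π₁ j₁ ≠ π₂ j₂) ∧ ¬ HodgeClassesProductSpan (⨁ fun j => A (π₁ j)) (⨁ fun j => A (π₂ j)) := by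
  haveI : Nonempty I := ⟨i₀⟩
  obtain ⟨Φ, hlt⟩ := exists_cmFamilyRank_add_card_lt_of_mem_of_le_fieldRange h01 hI a₀ b₀ _ hgal hk₀ hreal
  exact ⟨Φ, fun A ιA θ hA => exists_not_hodgeClassesProductSpan_of_cmFamilyRank_add_card_ne hA hlt.ne⟩

end Hodge

end Summit.HodgeConjecture.CorCM

end
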